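import Summits.AtomisticToContinuum.HydrodynamicLimit.Theorems.EquilibriumClampedCollisionalWindowLD.Negative.BaseParams

/-!
# Base parameters of the witness and their bounds, part 2 (admissibility, separation, window, gain numerics) (helper file of the refutation of `EquilibriumClampedCollisionalWindowLD`, stmt-AtomisticToContinuum-13733; see `Cruxes/EquilibriumClampedCollisionalWindowLD/Disproof.lean` and the evidence WITNESS.md; no Theses declaration is asserted positively; refuter-cdisprove-stmt-AtomisticToContinuum-13733-0)
-/

noncomputable section

open Real
open scoped InnerProductSpace

namespace Summit.AtomisticToContinuum.HydrodynamicLimit.Theorems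

namespace EquilibriumClampedCollisionalWindowLDNegative

section BasePar

namespace bpar

variable {l t : ℕ} (hl : 2 ≤ l) (ht : 24 * l ^ 2 ≤ t)
include hl ht

/-- `αn_bd` (technical, see the section header). [folklore] -/
theorem αn_bd : 0 ≤ (bpar l t).αn ∧ (bpar l t).αn ≤ 32 / (t : ℝ) ^ 32 := by
  have h1 := T1 hl ht; have hT := Tpos hl ht
  obtain ⟨ha1, ha2⟩ := αp_bd hl ht
  obtain ⟨hx, -, -⟩ := x_bd hl ht
  have hδ := δs_le hl ht; have hδ0 := δs_nn hl ht
  have hαs : 0 ≤ (bpar l t).αs := by rw [αs_eq]; positivity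
  have hps0 : 0 ≤ (bpar l t).ps ^ 2 / (bpar l t).ε := by rw [ε_eq]; positivity
  have hg := g_eq l t
  have hαp0 : 0 ≤ (bpar l t).αp := hαs.trans ha1
  simp only [Params.αn, hg, ε_eq]
  constructor
  · apply div_nonneg _ (by norm_num)
    have : 0 ≤ (bpar l t).ps ^ 2 / (4 / 5 : ℝ) := by positivity
    nlinarith
  · rw [div_le_iff₀ (by norm_num : (0:ℝ) < 4 / 5)]
    have h48 : (1 : ℝ) / (t : ℝ) ^ 48 ≤ 1 / (t : ℝ) ^ 32 := dle h1 zero_le_one le_rfl (by norm_num)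
    have e : (32 : ℝ) / (t : ℝ) ^ 32 * (4 / 5) = (128 / 5) / (t : ℝ) ^ 32 := by ring
    rw [e]
    have : (1 : ℝ) / 5 * (bpar l t).αp + 2 * (bpar l t).δs + (bpar l t).ps ^ 2 / (4 / 5) ≤
        (1 / 5) * (101 / (t : ℝ) ^ 32) + 2 * (2 / (t : ℝ) ^ 32) + 1 / (t : ℝ) ^ 32 := by
      have := hx; simp only [ε_eq] at this; nlinarith
    have e2 : (1 : ℝ) / 5 * (101 / (t : ℝ) ^ 32) + 2 * (2 / (t : ℝ) ^ 32) + 1 / (t : ℝ) ^ 32 = (126 / 5) / (t : ℝ) ^ 32 := by ring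
    have e3 : (126 / 5 : ℝ) / (t : ℝ) ^ 32 ≤ (128 / 5) / (t : ℝ) ^ 32 := dle h1 (by norm_num) (by norm_num) le_rfl
    linarith

/-- `clo_bd` (technical, see the section header). [folklore] -/
theorem clo_bd : (t : ℝ) ^ 3 - 2 ≤ (bpar l t).clo ∧ (bpar l t).clo ≤ (t : ℝ) ^ 3 := by
  have h1 := T1 hl ht; have hT := Tpos hl ht
  obtain ⟨hVlo1, hVlo2, -, -⟩ := V_bd hl ht
  obtain ⟨-, hx, hx0⟩ := x_bd hl ht
  have h48 : (1 : ℝ) / (t : ℝ) ^ 48 ≤ 1 / 96 := small hl ht (by norm_num)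
  have ht3 := T3 hl ht
  simp only [Params.clo]
  constructor
  · -- `(t³-1)(1 - x) ≥ t³ - 2` with `x ≤ 1/96/…`; use `Vlo ≥ t³-1 ≥ 0`, `x t³ ≤ 1`
    have hxT : (bpar l t).ps ^ 2 / (bpar l t).ε ^ 2 * (t : ℝ) ^ 3 ≤ 1 := by
      calc (bpar l t).ps ^ 2 / (bpar l t).ε ^ 2 * (t : ℝ) ^ 3 ≤ 1 / (t : ℝ) ^ 48 * (t : ℝ) ^ 3 :=
            mul_le_mul_of_nonneg_right hx (by positivity)
        _ = 1 / (t : ℝ) ^ 45 := by rw [mul_comm, show (48 : ℕ) = 3 + 45 from rfl, pmul h1]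
        _ ≤ 1 := by have := small hl ht (by norm_num : 1 ≤ 45); linarith
    nlinarith
  · nlinarith

/-- `ρs_bd` (technical, see the section header). [folklore] -/
theorem ρs_bd : 0 ≤ (bpar l t).ρs ∧ (bpar l t).ρs ≤ 300 / (t : ℝ) ^ 29 := by
  have h1 := T1 hl ht; have hT := Tpos hl ht
  obtain ⟨-, -, hVhi1, hVhi2⟩ := V_bd hl ht
  obtain ⟨hps0, hps⟩ := ps_bd hl ht
  obtain ⟨hu0, hu⟩ := u_bd hl ht
  have hVhi0 : 0 ≤ (bpar l t).Vhi := by have := pow_pos hT 3; linarith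
  simp only [Params.ρs, ε_eq]
  constructor
  · positivity
  · have h2 : 2 * (bpar l t).Vhi * (bpar l t).ps / (4 / 5) ≤ 2 * ((t : ℝ) ^ 3 + 1) * (103 / (t : ℝ) ^ 32) / (4 / 5) := by
      rw [div_le_div_iff_of_pos_right (by norm_num)]
      exact mul_le_mul (by linarith) hps hps0 (by positivity)
    have e : 2 * ((t : ℝ) ^ 3 + 1) * (103 / (t : ℝ) ^ 32) / (4 / 5) =
        (t : ℝ) ^ 3 * ((515 / 2) / (t : ℝ) ^ (3 + 29)) + (515 / 2) / (t : ℝ) ^ 32 := by ring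
    rw [e, pmul h1] at h2
    have h3 : (515 / 2 : ℝ) / (t : ℝ) ^ 32 ≤ (20 : ℝ) / (t : ℝ) ^ 29 :=
      (shrink hl ht (by norm_num) (by norm_num : 29 + 1 ≤ 32)).trans (dle h1 (by norm_num) (by norm_num) le_rfl)
    have h4 : (1 : ℝ) / (t : ℝ) ^ 40 ≤ (1 : ℝ) / (t : ℝ) ^ 29 := dle h1 (by norm_num) le_rfl (by norm_num)
    have e2 : (300 : ℝ) / (t : ℝ) ^ 29 = (515 / 2) / (t : ℝ) ^ 29 + 20 / (t : ℝ) ^ 29 + (45 / 2) / (t : ℝ) ^ 29 := by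
      rw [dadd, dadd]; norm_num
    have h5 : (1 : ℝ) / (t : ℝ) ^ 29 ≤ (45 / 2) / (t : ℝ) ^ 29 := dle h1 (by norm_num) (by norm_num) le_rfl
    linarith

/-- `Tρs_bd` (technical, see the section header). [folklore] -/
theorem Tρs_bd : (bpar l t).Tmax * (bpar l t).ρs ≤ 25 / (t : ℝ) ^ 24 := by
  have h1 := T1 hl ht; have hT := Tpos hl ht
  obtain ⟨hρ0, hρ⟩ := ρs_bd hl ht
  have hl2 := TL ht
  rw [T_eq]
  calc 2 * (t : ℝ) ^ 4 * (l : ℝ) ^ 2 * (bpar l t).ρs ≤ 2 * (t : ℝ) ^ 4 * (l : ℝ) ^ 2 * (300 / (t : ℝ) ^ 29) :=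
        mul_le_mul_of_nonneg_left hρ (by positivity)
    _ = (t : ℝ) ^ 4 * ((600 * (l : ℝ) ^ 2) / (t : ℝ) ^ (4 + 25)) := by ring
    _ = (600 * (l : ℝ) ^ 2) / (t : ℝ) ^ 25 := pmul h1 _ _ _
    _ ≤ (25 * t) / (t : ℝ) ^ 25 := div_le_div_of_nonneg_right (by linarith) (by positivity)
    _ = 25 / (t : ℝ) ^ 24 := by
        rw [show (t : ℝ) ^ 25 = (t : ℝ) ^ 1 * (t : ℝ) ^ 24 by ring, pow_one]; field_simp

/-- `Tu_bd` (technical, see the section header). [folklore] -/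
theorem Tu_bd : (bpar l t).Tmax * (bpar l t).u ≤ 1 / (t : ℝ) ^ 35 := by
  have h1 := T1 hl ht; have hT := Tpos hl ht
  have hl2 := TL ht
  rw [T_eq, u_eq]
  calc 2 * (t : ℝ) ^ 4 * (l : ℝ) ^ 2 * (4 / 5 / (t : ℝ) ^ 40) = (t : ℝ) ^ 4 * ((8 / 5 * (l : ℝ) ^ 2) / (t : ℝ) ^ (4 + 36)) := by
        ring
    _ = (8 / 5 * (l : ℝ) ^ 2) / (t : ℝ) ^ 36 := pmul h1 _ _ _
    _ ≤ t / (t : ℝ) ^ 36 := div_le_div_of_nonneg_right (by linarith) (by positivity)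
    _ = 1 / (t : ℝ) ^ 35 := by
        rw [show (t : ℝ) ^ 36 = (t : ℝ) ^ 1 * (t : ℝ) ^ 35 by ring, pow_one]; field_simp

/-- `errA = r + Tmax u + Tmax ρs ≤ 27/t²⁴`. -/
theorem errA_bd : 0 ≤ (bpar l t).r + (bpar l t).Tmax * (bpar l t).u + (bpar l t).Tmax * (bpar l t).ρs ∧
    (bpar l t).r + (bpar l t).Tmax * (bpar l t).u + (bpar l t).Tmax * (bpar l t).ρs ≤ 27 / (t : ℝ) ^ 24 := by
  have h1 := T1 hl ht; have hT := Tpos hl ht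
  have hρ := Tρs_bd hl ht; have hu := Tu_bd hl ht
  obtain ⟨hρ0, -⟩ := ρs_bd hl ht
  constructor
  · rw [r_eq, T_eq, u_eq]; positivity
  · rw [r_eq]
    have e1 : (4 / 5 : ℝ) / (t : ℝ) ^ 32 ≤ 1 / (t : ℝ) ^ 24 := dle h1 (by norm_num) (by norm_num) (by norm_num)
    have e2 : (1 : ℝ) / (t : ℝ) ^ 35 ≤ 1 / (t : ℝ) ^ 24 := dle h1 (by norm_num) le_rfl (by norm_num)
    have e3 : (27 : ℝ) / (t : ℝ) ^ 24 = 1 / (t : ℝ) ^ 24 + 1 / (t : ℝ) ^ 24 + 25 / (t : ℝ) ^ 24 := by rw [dadd, dadd]; norm_num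
    linarith

/-- `fwd = θhi Vhi + (r + Tmax u) + Tmax ρs ≤ 1/5 + 3/t²` (and `≥ 0`). -/
theorem fwd_bd : 0 ≤ (bpar l t).θhi * (bpar l t).Vhi + ((bpar l t).r + (bpar l t).Tmax * (bpar l t).u) +
      (bpar l t).Tmax * (bpar l t).ρs ∧
    (bpar l t).θhi * (bpar l t).Vhi + ((bpar l t).r + (bpar l t).Tmax * (bpar l t).u) +
      (bpar l t).Tmax * (bpar l t).ρs ≤ 1 / 5 + 3 / (t : ℝ) ^ 2 := by
  have h1 := T1 hl ht; have hT := Tpos hl ht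
  obtain ⟨hθhi, -, hθlo0, hθle⟩ := θ_bd hl ht
  obtain ⟨-, -, hVhi1, hVhi2⟩ := V_bd hl ht
  have hρ := Tρs_bd hl ht; have hu := Tu_bd hl ht
  obtain ⟨hρ0, -⟩ := ρs_bd hl ht
  have hθhi0 : 0 ≤ (bpar l t).θhi := hθlo0.le.trans hθle
  have hVhi0 : 0 ≤ (bpar l t).Vhi := by have := pow_pos hT 3; linarith
  constructor
  · rw [r_eq, T_eq, u_eq]; positivity
  · have hm : (bpar l t).θhi * (bpar l t).Vhi ≤ (1 / 5 + 1 / (t : ℝ) ^ 2) / (t : ℝ) ^ 3 * ((t : ℝ) ^ 3 + 1) :=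
      mul_le_mul hθhi hVhi2 hVhi0 (by positivity)
    have e : (1 / 5 + 1 / (t : ℝ) ^ 2) / (t : ℝ) ^ 3 * ((t : ℝ) ^ 3 + 1) =
        1 / 5 + 1 / (t : ℝ) ^ 2 + (1 / 5) / (t : ℝ) ^ 3 + 1 / (t : ℝ) ^ 5 := by
      field_simp; ring
    rw [e] at hm
    rw [r_eq]
    have e1 : (1 / 5 : ℝ) / (t : ℝ) ^ 3 ≤ (1 / 5) / (t : ℝ) ^ 2 := dle h1 (by norm_num) le_rfl (by norm_num)
    have e2 : (1 : ℝ) / (t : ℝ) ^ 5 ≤ (1 / 5) / (t : ℝ) ^ 2 :=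
      (shrink hl ht (by norm_num) (by norm_num : 2 + 1 ≤ 5)).trans (dle h1 (by norm_num) (by norm_num) le_rfl)
    have e3 : (4 / 5 : ℝ) / (t : ℝ) ^ 32 ≤ (1 / 5) / (t : ℝ) ^ 2 :=
      (shrink hl ht (by norm_num) (by norm_num : 2 + 1 ≤ 32)).trans (dle h1 (by norm_num) (by norm_num) le_rfl)
    have e4 : (1 : ℝ) / (t : ℝ) ^ 35 ≤ (1 / 5) / (t : ℝ) ^ 2 :=
      (shrink hl ht (by norm_num) (by norm_num : 2 + 1 ≤ 35)).trans (dle h1 (by norm_num) (by norm_num) le_rfl)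
    have e5 : (25 : ℝ) / (t : ℝ) ^ 24 ≤ (1 : ℝ) / (t : ℝ) ^ 2 :=
      (shrink hl ht (by norm_num) (by norm_num : 2 + 1 ≤ 24)).trans (dle h1 (by norm_num) (by norm_num) le_rfl)
    have e6 : (3 : ℝ) / (t : ℝ) ^ 2 = 1 / (t : ℝ) ^ 2 + (1 / 5) / (t : ℝ) ^ 2 + (1 / 5) / (t : ℝ) ^ 2 + (1 / 5) / (t : ℝ) ^ 2 +
        (1 / 5) / (t : ℝ) ^ 2 + 1 / (t : ℝ) ^ 2 + (1 / 5) / (t : ℝ) ^ 2 := by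
      simp only [dadd]; norm_num
    have e7 : 0 ≤ (1 / 5 : ℝ) / (t : ℝ) ^ 2 := by positivity
    linarith

/-- A small quantity `a/t^k` (`k ≥ 2`) is at most `a / 9216`. -/
theorem tiny {a : ℝ} (ha : 0 ≤ a) {k : ℕ} (hk : 2 ≤ k) : a / (t : ℝ) ^ k ≤ a / 9216 := by
  have h1 := T1 hl ht
  calc a / (t : ℝ) ^ k ≤ a / (t : ℝ) ^ 2 := dle h1 ha le_rfl hk
    _ ≤ a / 9216 := div_le_div_of_nonneg_left ha (by norm_num) (by have := T2 hl ht; nlinarith)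

/-- **The base constants are admissible** (`l ≥ 2`, `t ≥ 24 l²`). [folklore] -/
theorem adm : (bpar l t).Admissible := by
  have h1 := T1 hl ht; have hT := Tpos hl ht; have h96 := T96 hl ht
  obtain ⟨hps0, hps⟩ := ps_bd hl ht
  obtain ⟨hVlo1, hVlo2, hVhi1, hVhi2⟩ := V_bd hl ht
  obtain ⟨hθhi, hθlo, hθlo0, hθle⟩ := θ_bd hl ht
  obtain ⟨hαn0, hαn⟩ := αn_bd hl ht
  obtain ⟨hclo1, hclo2⟩ := clo_bd hl ht
  obtain ⟨hu0, hu⟩ := u_bd hl ht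
  obtain ⟨hν0, hν⟩ := νs_bd hl ht
  have ht3 := T3 hl ht; have ht2 := T2 hl ht; have hl2 := L2 hl
  have hl4 : (4 : ℝ) ≤ (l : ℝ) ^ 2 := by nlinarith
  refine
  { ε_pos := by rw [ε_eq]; norm_num
    ε_lt_s := by rw [ε_eq, s_eq]; norm_num
    s_le := by rw [ε_eq, s_eq]; norm_num
    V_pos := by rw [V_eq]; positivity
    r_nn := by rw [r_eq]; positivity
    u_nn := hu0
    T_nn := by rw [T_eq]; positivity
    αs_nn := by rw [αs_eq]; positivity
    small := ?_, Vlo_ge := ?_, Vhi_le := ?_, u_le := ?_, ps_le := ?_, α_closes := ?_, T_ge := ?_, νs_lt := ?_ }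
  · -- `s αp + δs = ps ≤ 103/t³² ≤ g/4 = 1/20`
    have hps' : (bpar l t).s * (bpar l t).αp + (bpar l t).δs = (bpar l t).ps := by simp [Params.ps]
    rw [hps', g_eq]
    have := tiny hl ht (by norm_num : (0:ℝ) ≤ 103) (by norm_num : 2 ≤ 32)
    linarith
  · rw [V_eq]; nlinarith
  · rw [V_eq]; nlinarith
  · rw [V_eq]; have := small hl ht (by norm_num : 1 ≤ 40); nlinarith
  · rw [ε_eq]; have := tiny hl ht (by norm_num : (0:ℝ) ≤ 103) (by norm_num : 2 ≤ 32); linarith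
  · -- `αn + 2u/(clo - u) ≤ 32/t³² + 2/t⁴⁰ ≤ 100/t³²`
    rw [αs_eq]
    have hcu : 1 ≤ (bpar l t).clo - (bpar l t).u := by
      have := small hl ht (by norm_num : 1 ≤ 40); nlinarith
    have h2u : 2 * (bpar l t).u / ((bpar l t).clo - (bpar l t).u) ≤ 2 * (bpar l t).u :=
      div_le_self (by linarith) hcu
    have h40 : (1 : ℝ) / (t : ℝ) ^ 40 ≤ 1 / (t : ℝ) ^ 32 := dle h1 zero_le_one le_rfl (by norm_num)
    have e : (100 : ℝ) / (t : ℝ) ^ 32 = 32 / (t : ℝ) ^ 32 + 68 * (1 / (t : ℝ) ^ 32) := by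
      rw [show (68 : ℝ) * (1 / (t : ℝ) ^ 32) = 68 / (t : ℝ) ^ 32 by ring, dadd]; norm_num
    linarith
  · -- `K θhi ≤ Tmax`
    rw [K_cast, T_eq]
    calc (6 * (t : ℝ) ^ 7 * (l : ℝ) ^ 2 + 2) * (bpar l t).θhi
        ≤ (6 * (t : ℝ) ^ 7 * (l : ℝ) ^ 2 + 2) * ((1 / 5 + 1 / (t : ℝ) ^ 2) / (t : ℝ) ^ 3) :=
          mul_le_mul_of_nonneg_left hθhi (by positivity)
      _ = (6 / 5) * (t : ℝ) ^ 4 * (l : ℝ) ^ 2 + 6 * (t : ℝ) ^ 2 * (l : ℝ) ^ 2 + (2 / 5) / (t : ℝ) ^ 3 + 2 / (t : ℝ) ^ 5 := by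
          field_simp; ring
      _ ≤ 2 * (t : ℝ) ^ 4 * (l : ℝ) ^ 2 := by
          have e1 := small hl ht (by norm_num : 1 ≤ 3)
          have e2 := small hl ht (by norm_num : 1 ≤ 5)
          have e3 : (2 / 5 : ℝ) / (t : ℝ) ^ 3 = (2 / 5) * (1 / (t : ℝ) ^ 3) := by ring
          have e4 : (2 : ℝ) / (t : ℝ) ^ 5 = 2 * (1 / (t : ℝ) ^ 5) := by ring
          have hY0 : (0 : ℝ) ≤ (t : ℝ) ^ 2 * (l : ℝ) ^ 2 := by positivity
          have hY : (4 : ℝ) * 9216 ≤ (t : ℝ) ^ 2 * (l : ℝ) ^ 2 := by nlinarith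
          have hXY : 9216 * ((t : ℝ) ^ 2 * (l : ℝ) ^ 2) ≤ (t : ℝ) ^ 2 * ((t : ℝ) ^ 2 * (l : ℝ) ^ 2) :=
            mul_le_mul_of_nonneg_right (by norm_num at ht2 ⊢; linarith) hY0
          have e5 : (t : ℝ) ^ 4 * (l : ℝ) ^ 2 = (t : ℝ) ^ 2 * ((t : ℝ) ^ 2 * (l : ℝ) ^ 2) := by ring
          have e7 : (t : ℝ) ^ 2 * (l : ℝ) ^ 2 = 1 * ((t : ℝ) ^ 2 * (l : ℝ) ^ 2) := by ring
          rw [show (6 : ℝ) / 5 * (t : ℝ) ^ 4 * (l : ℝ) ^ 2 = (6 / 5) * ((t : ℝ) ^ 4 * (l : ℝ) ^ 2) by ring,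
            show (6 : ℝ) * (t : ℝ) ^ 2 * (l : ℝ) ^ 2 = 6 * ((t : ℝ) ^ 2 * (l : ℝ) ^ 2) by ring,
            show (2 : ℝ) * (t : ℝ) ^ 4 * (l : ℝ) ^ 2 = 2 * ((t : ℝ) ^ 4 * (l : ℝ) ^ 2) by ring, e5]
          linarith
  · rw [g_eq]; have := small hl ht (by norm_num : 1 ≤ 32)
    have e : (3 : ℝ) / (t : ℝ) ^ 32 = 3 * (1 / (t : ℝ) ^ 32) := by ring
    linarith

/-- Numeric facts feeding `SepOK`, `WinOK`, `GainOK` at the base scale. [folklore] -/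
theorem sep_facts :
    (bpar l t).αs ≤ 1 ∧ (bpar l t).αn ≤ 1 ∧
    (bpar l t).ε + ((bpar l t).θhi * (bpar l t).Vhi + ((bpar l t).r + (bpar l t).Tmax * (bpar l t).u) +
        (bpar l t).Tmax * (bpar l t).ρs) +
      ((bpar l t).r + (bpar l t).Tmax * (bpar l t).u + (bpar l t).Tmax * (bpar l t).ρs) < 2 * (bpar l t).s ∧
    (bpar l t).ε < (bpar l t).ε * (1 - (bpar l t).αn ^ 2 / 2) +
      (bpar l t).θlo * ((bpar l t).Vlo + (bpar l t).u) * (1 - (bpar l t).αs ^ 2 / 2) -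
      2 * (bpar l t).Tmax * (bpar l t).ρs := by
  have h1 := T1 hl ht; have hT := Tpos hl ht; have h96 := T96 hl ht
  obtain ⟨hVlo1, hVlo2, hVhi1, hVhi2⟩ := V_bd hl ht
  obtain ⟨hθhi, hθlo, hθlo0, hθle⟩ := θ_bd hl ht
  obtain ⟨hαn0, hαn⟩ := αn_bd hl ht
  obtain ⟨hu0, hu⟩ := u_bd hl ht
  obtain ⟨he0, he⟩ := errA_bd hl ht
  obtain ⟨hf0, hf⟩ := fwd_bd hl ht
  have hρ := Tρs_bd hl ht
  have ht2 := T2 hl ht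
  have hαs1 : (bpar l t).αs ≤ 1 := by
    rw [αs_eq]; have := tiny hl ht (by norm_num : (0:ℝ) ≤ 100) (by norm_num : 2 ≤ 32); linarith
  have hαn1 : (bpar l t).αn ≤ 1 / 100 := by
    have := tiny hl ht (by norm_num : (0:ℝ) ≤ 32) (by norm_num : 2 ≤ 32); linarith
  refine ⟨hαs1, by linarith, ?_, ?_⟩
  · rw [ε_eq, s_eq]
    have e1 := tiny hl ht (by norm_num : (0:ℝ) ≤ 3) le_rfl
    have e2 := tiny hl ht (by norm_num : (0:ℝ) ≤ 27) (by norm_num : 2 ≤ 24)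
    linarith
  · -- adjSS
    have hθL0 : 0 ≤ (1 / 5 - 1 / (t : ℝ) ^ 2) / (t : ℝ) ^ 3 := by
      apply div_nonneg _ (by positivity)
      have := small hl ht (by norm_num : 1 ≤ 2); linarith
    have hVu : (t : ℝ) ^ 3 - 1 ≤ (bpar l t).Vlo + (bpar l t).u := by linarith
    have ht3 := T3 hl ht
    have hprod : (1 / 5 - 1 / (t : ℝ) ^ 2) / (t : ℝ) ^ 3 * ((t : ℝ) ^ 3 - 1) ≤
        (bpar l t).θlo * ((bpar l t).Vlo + (bpar l t).u) :=
      mul_le_mul hθlo hVu (by linarith) hθlo0.le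
    have e : (1 / 5 - 1 / (t : ℝ) ^ 2) / (t : ℝ) ^ 3 * ((t : ℝ) ^ 3 - 1) =
        1 / 5 - 1 / (t : ℝ) ^ 2 - (1 / 5) / (t : ℝ) ^ 3 + 1 / (t : ℝ) ^ 5 := by
      field_simp; ring
    rw [e] at hprod
    have e1 := small hl ht (by norm_num : 1 ≤ 2)
    have e2 : (1 / 5 : ℝ) / (t : ℝ) ^ 3 ≤ (1 / 5) / 96 := by
      have := small hl ht (by norm_num : 1 ≤ 3)
      have : (1 / 5 : ℝ) / (t : ℝ) ^ 3 = (1 / 5) * (1 / (t : ℝ) ^ 3) := by ring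
      linarith
    have e3 : (0 : ℝ) ≤ 1 / (t : ℝ) ^ 5 := by positivity
    have hθVu : 9 / 50 ≤ (bpar l t).θlo * ((bpar l t).Vlo + (bpar l t).u) := by linarith
    have hαs0 : 0 ≤ (bpar l t).αs := by rw [αs_eq]; positivity
    have hfac : 1 / 2 ≤ 1 - (bpar l t).αs ^ 2 / 2 := by
      have := pow_le_one₀ hαs0 hαs1 (n := 2); linarith
    have hmain : 9 / 50 * (1 / 2) ≤ (bpar l t).θlo * ((bpar l t).Vlo + (bpar l t).u) * (1 - (bpar l t).αs ^ 2 / 2) :=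
      mul_le_mul hθVu hfac (by norm_num) (by linarith)
    have hαn2 : (bpar l t).ε - 1 / 100 ≤ (bpar l t).ε * (1 - (bpar l t).αn ^ 2 / 2) := by
      rw [ε_eq]
      have : (bpar l t).αn ^ 2 ≤ (1 / 100) ^ 2 := pow_le_pow_left₀ hαn0 hαn1 2
      nlinarith
    have hρ' : 2 * (bpar l t).Tmax * (bpar l t).ρs ≤ 1 / 100 := by
      have := tiny hl ht (by norm_num : (0:ℝ) ≤ 25) (by norm_num : 2 ≤ 24)
      have e4 : 2 * (bpar l t).Tmax * (bpar l t).ρs = 2 * ((bpar l t).Tmax * (bpar l t).ρs) := by ring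
      linarith
    linarith

/-- Numeric facts for the window and the gain at the base scale:
`w̄ = t⁴ l²`, `kw = 4 t⁷ l²`. [folklore] -/
theorem win_facts :
    (t : ℝ) ^ 4 * (l : ℝ) ^ 2 ≤ (bpar l t).Tmax ∧
    (t : ℝ) ^ 4 * (l : ℝ) ^ 2 < (((bpar l t).K - 1 : ℕ) : ℝ) * (bpar l t).θlo ∧
    max (bpar l t).u (bpar l t).ρs ≤ (bpar l t).Vhi ∧
    ((4 * t ^ 7 * l ^ 2 : ℕ) : ℝ) * (bpar l t).θhi ≤ (t : ℝ) ^ 4 * (l : ℝ) ^ 2 ∧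
    4 * t ^ 7 * l ^ 2 + 1 ≤ (bpar l t).K ∧
    (bpar l t).ε + 2 * ((bpar l t).r + (bpar l t).Tmax * (bpar l t).u + (bpar l t).Tmax * (bpar l t).ρs) < (bpar l t).s ∧
    2 * (((bpar l t).θhi * (bpar l t).Vhi + ((bpar l t).r + (bpar l t).Tmax * (bpar l t).u) +
        (bpar l t).Tmax * (bpar l t).ρs) +
      ((bpar l t).r + (bpar l t).Tmax * (bpar l t).u + (bpar l t).Tmax * (bpar l t).ρs)) ≤ (bpar l t).s ∧
    (bpar l t).ε + 2 * ((bpar l t).θhi * (bpar l t).Vhi + ((bpar l t).r + (bpar l t).Tmax * (bpar l t).u) +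
        (bpar l t).Tmax * (bpar l t).ρs) < 8 ∧
    2 * Real.pi * (((bpar l t).r + (bpar l t).Tmax * (bpar l t).u + (bpar l t).Tmax * (bpar l t).ρs) +
        ((bpar l t).θhi * (bpar l t).Vhi + ((bpar l t).r + (bpar l t).Tmax * (bpar l t).u) +
        (bpar l t).Tmax * (bpar l t).ρs)) + Real.pi * (bpar l t).ε ≤ 39 / 10 ∧
    2 * (bpar l t).u ≤ (bpar l t).clo := by
  have h1 := T1 hl ht; have hT := Tpos hl ht; have h96 := T96 hl ht
  obtain ⟨hVlo1, hVlo2, hVhi1, hVhi2⟩ := V_bd hl ht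
  obtain ⟨hθhi, hθlo, hθlo0, hθle⟩ := θ_bd hl ht
  obtain ⟨hu0, hu⟩ := u_bd hl ht
  obtain ⟨he0, he⟩ := errA_bd hl ht
  obtain ⟨hf0, hf⟩ := fwd_bd hl ht
  obtain ⟨hρ0, hρ⟩ := ρs_bd hl ht
  obtain ⟨hclo1, hclo2⟩ := clo_bd hl ht
  have ht2 := T2 hl ht; have ht3 := T3 hl ht; have hl2 := L2 hl
  have hl4 : (4 : ℝ) ≤ (l : ℝ) ^ 2 := by nlinarith
  have e2 := small hl ht (by norm_num : 1 ≤ 2)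
  have hKm1 : (((bpar l t).K - 1 : ℕ) : ℝ) = 6 * (t : ℝ) ^ 7 * (l : ℝ) ^ 2 + 1 := by
    rw [K_eq, show 6 * t ^ 7 * l ^ 2 + 2 - 1 = 6 * t ^ 7 * l ^ 2 + 1 by omega]; push_cast; ring
  -- the key monomials `Y = t² l²`, `X = t² Y = t⁴ l²`
  have hY0 : (0 : ℝ) ≤ (t : ℝ) ^ 2 * (l : ℝ) ^ 2 := by positivity
  have hY : (4 : ℝ) * 9216 ≤ (t : ℝ) ^ 2 * (l : ℝ) ^ 2 := by nlinarith
  have hXY : 9216 * ((t : ℝ) ^ 2 * (l : ℝ) ^ 2) ≤ (t : ℝ) ^ 2 * ((t : ℝ) ^ 2 * (l : ℝ) ^ 2) :=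
    mul_le_mul_of_nonneg_right (by norm_num at ht2 ⊢; linarith) hY0
  have e6 : (t : ℝ) ^ 4 * (l : ℝ) ^ 2 = (t : ℝ) ^ 2 * ((t : ℝ) ^ 2 * (l : ℝ) ^ 2) := by ring
  refine ⟨?_, ?_, ?_, ?_, ?_, ?_, ?_, ?_, ?_, ?_⟩
  · rw [T_eq]; have : (0 : ℝ) ≤ (t : ℝ) ^ 4 * (l : ℝ) ^ 2 := by positivity
    linarith
  · rw [hKm1]
    calc (t : ℝ) ^ 4 * (l : ℝ) ^ 2 < (6 * (t : ℝ) ^ 7 * (l : ℝ) ^ 2 + 1) * ((1 / 5 - 1 / (t : ℝ) ^ 2) / (t : ℝ) ^ 3) := by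
          have e : (6 * (t : ℝ) ^ 7 * (l : ℝ) ^ 2 + 1) * ((1 / 5 - 1 / (t : ℝ) ^ 2) / (t : ℝ) ^ 3) =
              (6 / 5) * ((t : ℝ) ^ 4 * (l : ℝ) ^ 2) - 6 * ((t : ℝ) ^ 2 * (l : ℝ) ^ 2) + (1 / 5) / (t : ℝ) ^ 3 - 1 / (t : ℝ) ^ 5 := by
            field_simp; ring
          rw [e, e6]
          have e5 := small hl ht (by norm_num : 1 ≤ 5)
          have e3' : (0 : ℝ) ≤ (1 / 5) / (t : ℝ) ^ 3 := by positivity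
          linarith
      _ ≤ (6 * (t : ℝ) ^ 7 * (l : ℝ) ^ 2 + 1) * (bpar l t).θlo := mul_le_mul_of_nonneg_left hθlo (by positivity)
  · refine max_le ?_ ?_
    · have := small hl ht (by norm_num : 1 ≤ 40); linarith
    · have := small hl ht (by norm_num : 1 ≤ 29)
      have : (300 : ℝ) / (t : ℝ) ^ 29 = 300 * (1 / (t : ℝ) ^ 29) := by ring
      linarith
  · push_cast
    calc 4 * (t : ℝ) ^ 7 * (l : ℝ) ^ 2 * (bpar l t).θhi ≤ 4 * (t : ℝ) ^ 7 * (l : ℝ) ^ 2 * ((1 / 5 + 1 / (t : ℝ) ^ 2) / (t : ℝ) ^ 3) :=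
          mul_le_mul_of_nonneg_left hθhi (by positivity)
      _ = (4 / 5) * ((t : ℝ) ^ 4 * (l : ℝ) ^ 2) + 4 * ((t : ℝ) ^ 2 * (l : ℝ) ^ 2) := by field_simp
      _ ≤ (t : ℝ) ^ 4 * (l : ℝ) ^ 2 := by rw [e6]; linarith
  · rw [K_eq]
    have : 4 * t ^ 7 * l ^ 2 ≤ 6 * t ^ 7 * l ^ 2 := Nat.mul_le_mul_right _ (Nat.mul_le_mul_right _ (by norm_num))
    omega
  · rw [ε_eq, s_eq]
    have := tiny hl ht (by norm_num : (0:ℝ) ≤ 27) (by norm_num : 2 ≤ 24); linarith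
  · rw [s_eq]
    have := tiny hl ht (by norm_num : (0:ℝ) ≤ 27) (by norm_num : 2 ≤ 24)
    have := tiny hl ht (by norm_num : (0:ℝ) ≤ 3) le_rfl
    linarith
  · rw [ε_eq]
    have := tiny hl ht (by norm_num : (0:ℝ) ≤ 3) le_rfl
    linarith
  · rw [ε_eq]
    have hπ := Real.pi_lt_d2
    have hπ0 := Real.pi_pos
    have h27 := (shrink hl ht (by norm_num : (0:ℝ) ≤ 27) (by norm_num : 2 + 1 ≤ 24)).trans
      (tiny hl ht (by norm_num : (0:ℝ) ≤ 27 / 96) le_rfl)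
    have h3 := tiny hl ht (by norm_num : (0:ℝ) ≤ 3) le_rfl
    have hsum : ((bpar l t).r + (bpar l t).Tmax * (bpar l t).u + (bpar l t).Tmax * (bpar l t).ρs) +
        ((bpar l t).θhi * (bpar l t).Vhi + ((bpar l t).r + (bpar l t).Tmax * (bpar l t).u) +
        (bpar l t).Tmax * (bpar l t).ρs) ≤ 201 / 1000 := by linarith
    nlinarith
  · have := small hl ht (by norm_num : 1 ≤ 40); nlinarith

end bpar

end BasePar


end EquilibriumClampedCollisionalWindowLDNegative

end Summit.AtomisticToContinuum.HydrodynamicLimit.Theorems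

end
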